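import Literature.Combinatorics.Designs.DifferenceSetMultiplier
import Literature.Combinatorics.Designs.GoethalsSeidelArray
import Mathlib.Data.ZMod.Basic

/-!
# (+) control for family F10 in the kernel: the Paley `(23, 11, 5)` difference set and the circulant-core `H(24)`
Framing: lottery ticket; floor = certified bounds/negative ranges.

Cell `pub-namedobj`, target H, family F10 (one circulant core). The kernel exclusion at order 668
(`NoCyclicDifferenceSet667.lean`: no cyclic `(667,333,166)` difference set, no bordered-circulant `IsHadamardMatrix` on
`Option (ℤ/667)` with border column `+1`) is not vacuous: in the SAME normal form the classical Paley construction works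
at order 24. Kernel facts (all by `decide`, no `native_decide`): the quadratic residues
`{1, 2, 3, 4, 6, 8, 9, 12, 13, 16, 18} ⊆ ℤ/23` form a `(23, 11, 5)` difference set (`IsDifferenceSet`, Literature
`DifferenceSetMultiplier`), and the bordered circulant matrix on `Option (ℤ/23)` (border row and column `+1`, core
`c (j - i)` with `c = +1` on the residues, `-1` elsewhere) is a Hadamard matrix of order 24 (`IsHadamardMatrix`,
Literature `GoethalsSeidelArray`). Replication of a classical object (Paley 1933); zero compute; no `sorry`.
-/

namespace Summit.Ventures.DiscreteObjects.Hadamard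

open Finset
open Literature.Combinatorics.Designs.DifferenceSets
open Literature.Combinatorics.Designs.GoethalsSeidel (IsHadamardMatrix)

/-- the quadratic residues modulo 23 (local notation, not a definition) -/
local notation "qr23" => ({1, 2, 3, 4, 6, 8, 9, 12, 13, 16, 18} : Finset (ZMod 23))

/-- **The Paley `(23, 11, 5)` difference set**: the quadratic residues modulo `23`. -/
theorem paley23_isDifferenceSet : IsDifferenceSet qr23 5 := by
  unfold IsDifferenceSet
  decide +kernel

/-- it has `11` elements -/
theorem paley23_card : (qr23).card = 11 := by decide

/-- **A Hadamard matrix of order 24 with a circulant core** (bordered Paley matrix), in the normal form of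
`no_hadamard668_circulant_core`: index set `Option (ℤ/23)`, border row and column `+1`, core entry `(some i, some j)`
equal to `+1` if `j - i` is a non-zero square modulo `23` and `-1` otherwise. -/
theorem circulantCore24_isHadamard :
    IsHadamardMatrix (Matrix.of fun (a b : Option (ZMod 23)) =>
      match a, b with
      | none, _ => (1 : ℤ)
      | some _, none => 1
      | some i, some j => if j - i ∈ qr23 then 1 else -1) := by
  unfold IsHadamardMatrix
  constructor
  · decide +kernel
  · decide +kernel

end Summit.Ventures.DiscreteObjects.Hadamard
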